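import Summits.QuantumAdvantage.AdviceFreeQNC0.AffBells35PolyLossOfIFM
import Literature.Computability.MetaComplexity.CosetFourier
import Summits.QuantumAdvantage.AdviceFreeQNC0.AffBells29ThinTail
import Literature.Computability.MetaComplexity.DualGridSZ
import HarnessLib

/-!
# qa-qnc0-p1 g35 — `PolyLossOfWREL` and the wired-elimination line, part 1/7: `PolyLossOfWREL` — (NP₁) ⟸ wide-row elimination; the split `WREL ⟸ ComponentElimination ∧ NoWires / WiredElimination`


`WideRowElimination → AffBellsPolyLoss3`.  A near-perfect strategy (imperfect-fibre mass `< 2^{N−1}/N^{e+2}`) with wide rows is reduced,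
one `WideRowElimination` step at a time (each step fires a set of rows containing a wide one at imperfect-mass cost `≤ 2^{N−1}/N^{e+2}`),
to a `(log₂ N)^C`-local strategy that still wins on `≥ (1 − 2/N^{e+1})·2^{N−1}` odd inputs — contradicting the LANDED cover hardness
`AffBells34.affCoverPolylogHard` (with `W = ∅`).  Hence every strategy has imperfect mass `≥ 2^{N−1}/N^{e+2}`, and
`affWinCard_le_of_imperfect` turns that into the polynomial loss.

Ported to the tree VERBATIM (split into seven files `AffBells35PolyLossOfWREL` / `AffBells35WREL{Firing,Quiet,Typical,Structure,Twins,Toggle}` for the 400-line rule; lint fixes only: `push Not`, `card_filter_add_card_filter_not`, unused simp arguments, two `_`-binders) by the prover seat qn-prover-3 g20 at the ask of planner qa-qnc0-p1 g36 (INBOX 11:15Z: exp35/WREL35.lean FROZEN, 1891 l., farm rc 0 / 0 sorry); authored and proved by the planner seat qa-qnc0-p1 g35.  Serves the crux stmt-QuantumAdvantage-22907 (route DWalkThree); untagged (the gate refuses `--supports` across sub-problems on AdviceFreeQNC0/ targets).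
-/

/-! Finite facts about `ℤ₃` and the signed coin increments `sdelta` (decided BEFORE `Classical` is opened). -/
namespace Summit.QuantumAdvantage.AdviceFreeQNC0.AffBells35.Z3

/-- `sd_ne_sd` (planner qa-qnc0-p1 g35, exp35/WREL35.lean; see the section header above). -/
theorem sd_ne_sd (b : Bool) (p q : ZMod 3) : ((if b then -p else p) ≠ (if b then -q else q)) ↔ p ≠ q := by
  revert b p q; decide
/-- `sd_ne_two_sd` (planner qa-qnc0-p1 g35, exp35/WREL35.lean; see the section header above). -/
theorem sd_ne_two_sd (b : Bool) (p q : ZMod 3) : ((if b then -p else p) ≠ 2 * (if b then -q else q)) ↔ p ≠ 2 * q := by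
  revert b p q; decide
/-- `two_sd_ne_sd` (planner qa-qnc0-p1 g35, exp35/WREL35.lean; see the section header above). -/
theorem two_sd_ne_sd (b : Bool) (p q : ZMod 3) : (2 * (if b then -p else p) ≠ (if b then -q else q)) ↔ p ≠ 2 * q := by
  revert b p q; decide
/-- `two_sd_ne_two_sd` (planner qa-qnc0-p1 g35, exp35/WREL35.lean; see the section header above). -/
theorem two_sd_ne_two_sd (b : Bool) (p q : ZMod 3) : (2 * (if b then -p else p) ≠ 2 * (if b then -q else q)) ↔ p ≠ q := by
  revert b p q; decide
/-- `sd_ne_zero` (planner qa-qnc0-p1 g35, exp35/WREL35.lean; see the section header above). -/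
theorem sd_ne_zero (b : Bool) (p : ZMod 3) : ((if b then -p else p) ≠ 0) ↔ p ≠ 0 := by
  revert b p; decide
/-- `two_ne_zero` (planner qa-qnc0-p1 g35, exp35/WREL35.lean; see the section header above). -/
theorem two_ne_zero : (2 : ZMod 3) ≠ 0 := by decide
/-- `two_sd_ne_zero` (planner qa-qnc0-p1 g35, exp35/WREL35.lean; see the section header above). -/
theorem two_sd_ne_zero (b : Bool) (p : ZMod 3) : (2 * (if b then -p else p) ≠ 0) ↔ p ≠ 0 := by
  revert b p; decide

/-- `neg2_sd_ne_sd` (planner qa-qnc0-p1 g35, exp35/WREL35.lean; see the section header above). -/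
theorem neg2_sd_ne_sd (b : Bool) (p q : ZMod 3) : ((if b then -(2 * p) else 2 * p) ≠ (if b then -q else q)) ↔ p ≠ 2 * q := by
  revert b p q; decide
/-- `sd_ne_neg2_sd` (planner qa-qnc0-p1 g35, exp35/WREL35.lean; see the section header above). -/
theorem sd_ne_neg2_sd (b : Bool) (p q : ZMod 3) : ((if b then -p else p) ≠ (if b then -(2 * q) else 2 * q)) ↔ p ≠ 2 * q := by
  revert b p q; decide
/-- `neg2_sd_ne_neg2_sd` (planner qa-qnc0-p1 g35, exp35/WREL35.lean; see the section header above). -/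
theorem neg2_sd_ne_neg2_sd (b : Bool) (p q : ZMod 3) : ((if b then -(2 * p) else 2 * p) ≠ (if b then -(2 * q) else 2 * q)) ↔ p ≠ q := by
  revert b p q; decide
/-- `neg2_sd_ne_zero` (planner qa-qnc0-p1 g35, exp35/WREL35.lean; see the section header above). -/
theorem neg2_sd_ne_zero (b : Bool) (p : ZMod 3) : ((if b then -(2 * p) else 2 * p) ≠ 0) ↔ p ≠ 0 := by
  revert b p; decide

/-- `two_mul_eq_iff` (planner qa-qnc0-p1 g35, exp35/WREL35.lean; see the section header above). -/
theorem two_mul_eq_iff (p q : ZMod 3) : 2 * p = q ↔ p = 2 * q := by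
  revert p q; decide

end Summit.QuantumAdvantage.AdviceFreeQNC0.AffBells35.Z3

noncomputable section
open Classical

namespace Summit.QuantumAdvantage.AdviceFreeQNC0.AffBells35

open Finset Literature.Computability.QuantumComplexity Literature.Computability.QuantumComplexity.RingHLF
open AffBells23 Fib19 AffBells26 AffBells29

variable {N : ℕ}

/-- Replace the rows of `K` by ALWAYS-fire rows `(β_h, c_h) := (0, 0)`. -/
def fireRows (β : Fin N → Fin N → ZMod 3) (K : Finset (Fin N)) : Fin N → Fin N → ZMod 3 :=
  fun h i => if h ∈ K then 0 else β h i

/-- Residues after replacing the rows of `K` by always-fire rows. -/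
def fireRes (c : Fin N → ZMod 3) (K : Finset (Fin N)) : Fin N → ZMod 3 :=
  fun h => if h ∈ K then 0 else c h

/-- **P-38ag `WideRowElimination`** (the crux; ROUND-34 §12.12(m)).  ONE level `e` (ours, large) suffices for the assembly: if the
imperfect-fibre mass is `≤ 2·2^{N-1}/N^{e+1}` and some row is wider than `(log₂ N)^C`, a set `K` containing a wide row can be switched to
constant rows (zero forms, ARBITRARY new residues `c'`: `0` = always-true, `≠ 0` = always-false) at the price of `≤ 2^{N-1}/N^{e+2}`
additional imperfect mass. -/
def WideRowElimination : Prop :=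
  ∃ C e n₀ : ℕ, ∀ N ≥ n₀, ∀ (β : Fin N → Fin N → ZMod 3) (c : Fin N → ZMod 3),
    (imperfectFibres β c).card * N ^ (e + 1) ≤ 2 * 2 ^ (N - 1) →
    (∃ h, (Nat.log 2 N) ^ C < (rowSupp β h).card) →
    ∃ (K : Finset (Fin N)) (c' : Fin N → ZMod 3), (∃ h ∈ K, (Nat.log 2 N) ^ C < (rowSupp β h).card) ∧
      (imperfectFibres (fireRows β K) c').card * N ^ (e + 2)
        ≤ (imperfectFibres β c).card * N ^ (e + 2) + 2 ^ (N - 1)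

/-- the wide rows of `β` at threshold `(log₂ N)^C` -/
def wideRows (C : ℕ) (β : Fin N → Fin N → ZMod 3) : Finset (Fin N) :=
  univ.filter fun h => (Nat.log 2 N) ^ C < (rowSupp β h).card

/-- `rowSupp_fireRows_of_mem` (planner qa-qnc0-p1 g35, exp35/WREL35.lean; see the section header above). -/
theorem rowSupp_fireRows_of_mem {β : Fin N → Fin N → ZMod 3} {K : Finset (Fin N)} {h : Fin N} (hh : h ∈ K) :
    rowSupp (fireRows β K) h = ∅ := by
  unfold rowSupp fireRows
  simp [hh]

/-- `rowSupp_fireRows_of_not_mem` (planner qa-qnc0-p1 g35, exp35/WREL35.lean; see the section header above). -/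
theorem rowSupp_fireRows_of_not_mem {β : Fin N → Fin N → ZMod 3} {K : Finset (Fin N)} {h : Fin N} (hh : h ∉ K) :
    rowSupp (fireRows β K) h = rowSupp β h := by
  unfold rowSupp fireRows
  simp [hh]

/-- firing a set containing a wide row strictly decreases the number of wide rows -/
theorem wideRows_fire_lt (C : ℕ) (β : Fin N → Fin N → ZMod 3) (K : Finset (Fin N))
    (hK : ∃ h ∈ K, (Nat.log 2 N) ^ C < (rowSupp β h).card) :
    (wideRows C (fireRows β K)).card < (wideRows C β).card := by
  obtain ⟨h, hhK, hwide⟩ := hK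
  apply Finset.card_lt_card
  refine ⟨?_, ?_⟩
  · intro g hg
    have hg' := (mem_filter.1 hg).2
    by_cases hgK : g ∈ K
    · rw [rowSupp_fireRows_of_mem hgK] at hg'
      simp at hg'
    · rw [rowSupp_fireRows_of_not_mem hgK] at hg'
      exact mem_filter.2 ⟨mem_univ _, hg'⟩
  · intro hsub
    have hmem : h ∈ wideRows C β := mem_filter.2 ⟨mem_univ _, hwide⟩
    have := (mem_filter.1 (hsub hmem)).2
    rw [rowSupp_fireRows_of_mem hhK] at this
    simp at this

/-- losers lie in imperfect fibres -/
theorem losers_card_le_imperfect (β : Fin N → Fin N → ZMod 3) (c : Fin N → ZMod 3) :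
    (losers β c).card ≤ (imperfectFibres β c).card := by
  apply Finset.card_le_card
  intro x hx
  have hx' := (mem_filter.1 hx).2
  refine mem_filter.2 ⟨mem_univ _, hx'.1, ?_⟩
  exact ⟨x, hx'.1, rfl, hx'.2⟩

/-- The iteration: from a strategy with `≤ k` wide rows and budget, reach a light strategy paying `≤ k·2^{N−1}`. -/
theorem wrel_iterate {C e N : ℕ} (hN : 1 ≤ N)
    (hstep : ∀ (β : Fin N → Fin N → ZMod 3) (c : Fin N → ZMod 3),
      (imperfectFibres β c).card * N ^ (e + 1) ≤ 2 * 2 ^ (N - 1) →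
      (∃ h, (Nat.log 2 N) ^ C < (rowSupp β h).card) →
      ∃ (K : Finset (Fin N)) (c' : Fin N → ZMod 3), (∃ h ∈ K, (Nat.log 2 N) ^ C < (rowSupp β h).card) ∧
        (imperfectFibres (fireRows β K) c').card * N ^ (e + 2)
          ≤ (imperfectFibres β c).card * N ^ (e + 2) + 2 ^ (N - 1)) :
    ∀ k : ℕ, ∀ (β : Fin N → Fin N → ZMod 3) (c : Fin N → ZMod 3),
      (wideRows C β).card ≤ k →
      (imperfectFibres β c).card * N ^ (e + 2) + k * 2 ^ (N - 1) ≤ 2 * N * 2 ^ (N - 1) →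
      ∃ (β' : Fin N → Fin N → ZMod 3) (c' : Fin N → ZMod 3),
        (∀ h, (rowSupp β' h).card ≤ (Nat.log 2 N) ^ C) ∧
        (imperfectFibres β' c').card * N ^ (e + 2) ≤ (imperfectFibres β c).card * N ^ (e + 2) + k * 2 ^ (N - 1) := by
  intro k
  induction k with
  | zero =>
      intro β c hw _
      refine ⟨β, c, fun h => ?_, by simp⟩
      by_contra hlt
      push Not at hlt
      have : h ∈ wideRows C β := mem_filter.2 ⟨mem_univ _, hlt⟩
      rw [Finset.card_eq_zero.1 (Nat.le_zero.1 hw)] at this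
      simp at this
  | succ k ih =>
      intro β c hw hbudget
      by_cases hlight : ∀ h, (rowSupp β h).card ≤ (Nat.log 2 N) ^ C
      · exact ⟨β, c, hlight, by omega⟩
      · push Not at hlight
        -- WREL hypothesis from the budget
        have hhyp : (imperfectFibres β c).card * N ^ (e + 1) ≤ 2 * 2 ^ (N - 1) := by
          have h1 : (imperfectFibres β c).card * N ^ (e + 2) ≤ 2 * N * 2 ^ (N - 1) := by omega
          have h2 : (imperfectFibres β c).card * N ^ (e + 2) = ((imperfectFibres β c).card * N ^ (e + 1)) * N := by
            rw [pow_succ]; ring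
          rw [h2, show 2 * N * 2 ^ (N - 1) = (2 * 2 ^ (N - 1)) * N by ring] at h1
          exact Nat.le_of_mul_le_mul_right h1 (by omega)
        obtain ⟨K, c₁, hKwide, hKcost⟩ := hstep β c hhyp hlight
        have hlt := wideRows_fire_lt C β K hKwide
        have hw' : (wideRows C (fireRows β K)).card ≤ k := by omega
        have hbudget' : (imperfectFibres (fireRows β K) c₁).card * N ^ (e + 2) + k * 2 ^ (N - 1)
            ≤ 2 * N * 2 ^ (N - 1) := by
          have : (k + 1) * 2 ^ (N - 1) = k * 2 ^ (N - 1) + 2 ^ (N - 1) := by ring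
          omega
        obtain ⟨β', c', hlight', hcost'⟩ := ih (fireRows β K) c₁ hw' hbudget'
        refine ⟨β', c', hlight', ?_⟩
        have : (k + 1) * 2 ^ (N - 1) = k * 2 ^ (N - 1) + 2 ^ (N - 1) := by ring
        omega

/-- **P-38ah `PolyLossOfWREL` PROVED.** -/
theorem polyLoss_of_wrel (h : WideRowElimination) : AffBellsPolyLoss3 := by
  obtain ⟨C, e, n₀, hn₀⟩ := h
  obtain ⟨θ, hθ, hcov⟩ := AffBells34.affCoverPolylogHard
  obtain ⟨n₁, hn₁⟩ := hcov C
  obtain ⟨ef, hef⟩ := affWinCard_le_of_imperfect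
  obtain ⟨M, hM⟩ := exists_nat_gt (2 / (1 - θ))
  refine ⟨e + 2 + 2 * ef, max (max n₀ n₁) (max M 3), fun N hN β c => ?_⟩
  have hNn₀ : n₀ ≤ N := le_trans (le_trans (le_max_left _ _) (le_max_left _ _)) hN
  have hNn₁ : n₁ ≤ N := le_trans (le_trans (le_max_right _ _) (le_max_left _ _)) hN
  have hNM : M ≤ N := le_trans (le_trans (le_max_left _ _) (le_max_right _ _)) hN
  have hN3 : 3 ≤ N := le_trans (le_trans (le_max_right _ _) (le_max_right _ _)) hN
  have hN1 : (1 : ℝ) ≤ N := by exact_mod_cast (show 1 ≤ N by omega)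
  have hNpos : (0 : ℝ) < N := by linarith
  have h2pos : (0 : ℝ) < (2 : ℝ) ^ (N - 1) := pow_pos (by norm_num) _
  by_cases hcase : 2 ^ (N - 1) ≤ N ^ (e + 2) * (imperfectFibres β c).card
  · -- Case 1: imperfect mass ≥ 2^{N-1}/N^{e+2} ⇒ polynomial loss
    have himp : (2 : ℝ) ^ (N - 1) ≤ (N : ℝ) ^ (e + 2) * ((imperfectFibres β c).card : ℝ) := by exact_mod_cast hcase
    exact hef (e + 2) N hN3 β c himp
  · -- Case 2: near-perfect ⇒ contradiction via the iteration and cover hardness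
    exfalso
    push Not at hcase
    -- run the iteration with k = number of wide rows ≤ N
    have hk : (wideRows C β).card ≤ N := by
      calc (wideRows C β).card ≤ (univ : Finset (Fin N)).card := card_le_card (subset_univ _)
        _ = N := by rw [card_univ, Fintype.card_fin]
    obtain ⟨β', c', hlight, hcost⟩ :=
      wrel_iterate (C := C) (e := e) (N := N) (by omega) (hn₀ N hNn₀) (wideRows C β).card β c le_rfl
        (by
          have h1 : (imperfectFibres β c).card * N ^ (e + 2) < 2 ^ (N - 1) := by
            rw [mul_comm]; exact hcase
          have h2 : (wideRows C β).card * 2 ^ (N - 1) ≤ N * 2 ^ (N - 1) := Nat.mul_le_mul_right _ hk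
          have h3 : 2 ^ (N - 1) ≤ N * 2 ^ (N - 1) := Nat.le_mul_of_pos_left _ (by omega)
          nlinarith)
    -- imperfect mass of the light strategy: #imp'·N^{e+2} ≤ #imp·N^{e+2} + N·2^{N-1} < (N+1)·2^{N-1}
    have hcost2 : (imperfectFibres β' c').card * N ^ (e + 2) < (N + 1) * 2 ^ (N - 1) := by
      have h1 : (imperfectFibres β c).card * N ^ (e + 2) < 2 ^ (N - 1) := by
        rw [mul_comm]; exact hcase
      have h2 : (wideRows C β).card * 2 ^ (N - 1) ≤ N * 2 ^ (N - 1) := Nat.mul_le_mul_right _ hk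
      nlinarith
    -- the light strategy loses few: losers' ≤ #imp' and affWinCard' + losers' = 2^{N-1}
    have hsum : (affWinCard β' c' : ℝ) + ((losers β' c').card : ℝ) = (2 : ℝ) ^ (N - 1) := by
      exact_mod_cast affWinCard_add_losers (by omega) β' c'
    have hlos : ((losers β' c').card : ℝ) ≤ ((imperfectFibres β' c').card : ℝ) := by
      exact_mod_cast losers_card_le_imperfect β' c'
    have hcostR : ((imperfectFibres β' c').card : ℝ) * (N : ℝ) ^ (e + 2) < ((N : ℝ) + 1) * (2 : ℝ) ^ (N - 1) := by
      exact_mod_cast hcost2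
    -- cover hardness for the light strategy with W = ∅
    have hwin : (affWinCard β' c' : ℝ) ≤ θ * (2 : ℝ) ^ (N - 1) := by
      refine hn₁ N hNn₁ β' c' ∅ (by simp) ?_
      intro b; simpa using hlight b
    -- arithmetic: (1-θ)·2^{N-1} ≤ #imp' and #imp'·N² < (N+1)·2^{N-1} give (1-θ)·N² < N+1, impossible for N ≥ M > 2/(1-θ)
    have hNsq : (0 : ℝ) < (N : ℝ) ^ (e + 2) := by positivity
    have hX : (1 - θ) * (2 : ℝ) ^ (N - 1) ≤ ((imperfectFibres β' c').card : ℝ) := by linarith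
    have hY' : (1 - θ) * (N : ℝ) ^ (e + 2) < (N : ℝ) + 1 := by
      have h1 : (1 - θ) * (2 : ℝ) ^ (N - 1) * (N : ℝ) ^ (e + 2) ≤ ((imperfectFibres β' c').card : ℝ) * (N : ℝ) ^ (e + 2) :=
        mul_le_mul_of_nonneg_right hX hNsq.le
      have h2 : (1 - θ) * (N : ℝ) ^ (e + 2) * (2 : ℝ) ^ (N - 1) < ((N : ℝ) + 1) * (2 : ℝ) ^ (N - 1) := by
        calc (1 - θ) * (N : ℝ) ^ (e + 2) * (2 : ℝ) ^ (N - 1) = (1 - θ) * (2 : ℝ) ^ (N - 1) * (N : ℝ) ^ (e + 2) := by ring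
          _ ≤ ((imperfectFibres β' c').card : ℝ) * (N : ℝ) ^ (e + 2) := h1
          _ < ((N : ℝ) + 1) * (2 : ℝ) ^ (N - 1) := hcostR
      exact lt_of_mul_lt_mul_right h2 h2pos.le
    have h1θ' : (0 : ℝ) ≤ 1 - θ := by linarith
    have hpow : (N : ℝ) ^ 2 ≤ (N : ℝ) ^ (e + 2) := pow_le_pow_right₀ hN1 (by omega)
    have hY : (1 - θ) * (N : ℝ) ^ 2 < (N : ℝ) + 1 :=
      lt_of_le_of_lt (mul_le_mul_of_nonneg_left hpow h1θ') hY'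
    have h1θ : (0 : ℝ) < 1 - θ := by linarith
    have hθN : 2 < (1 - θ) * (N : ℝ) := by
      have hMR : 2 / (1 - θ) < (N : ℝ) := lt_of_lt_of_le hM (by exact_mod_cast hNM)
      rw [div_lt_iff₀ h1θ] at hMR
      linarith
    have hprod : 2 * (N : ℝ) < (1 - θ) * (N : ℝ) * (N : ℝ) := by
      have := mul_lt_mul_of_pos_right hθN hNpos
      linarith
    have hsq : (1 - θ) * (N : ℝ) ^ 2 = (1 - θ) * (N : ℝ) * (N : ℝ) := by ring
    rw [hsq] at hY
    linarith


/-! ### The two-piece split of the crux: `WideRowElimination ⟸ ComponentElimination ∧ NoWires` (ROUND-34 §12.12(n3),(s))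

`ComponentElimination` (pure `dualSZDecoupling` + hard-core typicality + the exact bookkeeping; NO near-perfectness needed): firing the whole
POSITION COMPONENT of a row costs at most the atypical mass, provided the component contains no light row.  `NoWires` (THE LAST BOX): in a
near-perfect strategy the position component of a wide row contains no light row (no WIRE from the light to the wide regime). -/

/-- Position nearness of two rows at radius `R`: the forms differ on `< R` positions, or one is within `R` of TWICE the other
(conjugate link: the exponents `w_g` and `2·w_h` are then coin-near on every fibre). -/
def NearRows (R : ℕ) (β : Fin N → Fin N → ZMod 3) (g h : Fin N) : Prop :=
  (univ.filter fun i => β g i ≠ β h i).card < R ∨ (univ.filter fun i => β g i ≠ 2 * β h i).card < R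

/-- The POSITION COMPONENT of row `b` at radius `R`: rows reachable from `b` by `NearRows R` links. -/
def posComponent (R : ℕ) (β : Fin N → Fin N → ZMod 3) (b : Fin N) : Finset (Fin N) :=
  univ.filter fun g => Relation.ReflTransGen (NearRows R β) b g

/-- `mem_posComponent_self` (planner qa-qnc0-p1 g35, exp35/WREL35.lean; see the section header above). -/
theorem mem_posComponent_self (R : ℕ) (β : Fin N → Fin N → ZMod 3) (b : Fin N) : b ∈ posComponent R β b :=
  mem_filter.2 ⟨mem_univ _, Relation.ReflTransGen.refl⟩

/-- **P-38aj `ComponentElimination` (M/L; ROUND-34 §12.12(n3)).**  For every level `e` there are radii `C₁ log₂N` (links) and `C₂ log₂N`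
(light threshold) such that firing the position component `K` of ANY row whose component is light-free costs `≤ 2^{N−1}/N^{e+2}` imperfect
mass.  Proof plan: outside an atypical fibre set of mass `≤ 2^{N−1}/N^{e+2}` (hard-core large deviations, P-38aa: rows at position distance
`≥ C₁ log N` are at coin distance `≥ D ≈ 4 log₂ N + 8`, rows of width `≥ C₂ log N` have `≥ D` coins), every coin-`D`-component of active
exponents meeting `K` lies inside `K` and is `D`-wide, hence exactly silent on a PERFECT fibre by `dualSZDecoupling`
(`9(2N+2)²(N+1)² < 2^D`); so the outcome of every input of a typical perfect fibre is unchanged (bookkeeping: bell `= 1 + pair`,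
`TargetFormula`), typical imperfect fibres are already counted, atypical ones are the cost.  No near-perfectness hypothesis. -/
def ComponentElimination : Prop :=
  ∀ e : ℕ, ∃ C₁ C₂ n₀ : ℕ, ∀ N ≥ n₀, ∀ (β : Fin N → Fin N → ZMod 3) (c : Fin N → ZMod 3) (b : Fin N),
    (∀ g ∈ posComponent (C₁ * Nat.log 2 N) β b, C₂ * Nat.log 2 N ≤ (rowSupp β g).card) →
    (imperfectFibres (fireRows β (posComponent (C₁ * Nat.log 2 N) β b))
        (fireRes c (posComponent (C₁ * Nat.log 2 N) β b))).card * N ^ (e + 2)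
      ≤ (imperfectFibres β c).card * N ^ (e + 2) + 2 ^ (N - 1)

/-- **P-38ak `NoWires` (L; THE LAST BOX, ROUND-34 §12.12(n2),(o),(s)).**  At some level `e₀` (uniformly in the radii): a strategy with
imperfect mass `≤ 2·2^{N−1}/N^{e₀+1}` has no WIRE — the position component (radius `C₁ log₂ N`) of a row wider than `(log₂ N)^C` contains no
row of width `< C₂ log₂ N`.  Why it might fail: a thick dressed staircase (trichromatic crowd along a chain of 1-coin differences) that is
exactly silent on every typical fibre; (n1) bichromatic rigidity + (o) bichromatic exclusion say the dressing must supply trident relations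
at activity-robust trichromatic coordinates all along the wire — no such gadget is known (K-90: bare staircases are far from perfect). -/
def NoWires : Prop :=
  ∃ e₀ : ℕ, ∀ C₁ C₂ : ℕ, ∃ C n₀ : ℕ, ∀ N ≥ n₀, ∀ (β : Fin N → Fin N → ZMod 3) (c : Fin N → ZMod 3),
    (imperfectFibres β c).card * N ^ (e₀ + 1) ≤ 2 * 2 ^ (N - 1) →
    ∀ b, (Nat.log 2 N) ^ C < (rowSupp β b).card →
      ∀ g ∈ posComponent (C₁ * Nat.log 2 N) β b, C₂ * Nat.log 2 N ≤ (rowSupp β g).card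

/-- **The split is a proof:** `ComponentElimination → NoWires → WideRowElimination`. -/
theorem wrel_of_split (hCE : ComponentElimination) (hNW : NoWires) : WideRowElimination := by
  obtain ⟨e₀, hNW⟩ := hNW
  obtain ⟨C₁, C₂, n₀, hCE⟩ := hCE e₀
  obtain ⟨C, n₁, hNW⟩ := hNW C₁ C₂
  refine ⟨C, e₀, max n₀ n₁, fun N hN β c himp hwide => ?_⟩
  obtain ⟨h, hh⟩ := hwide
  refine ⟨posComponent (C₁ * Nat.log 2 N) β h, fireRes c (posComponent (C₁ * Nat.log 2 N) β h),
    ⟨h, mem_posComponent_self _ _ _, hh⟩, ?_⟩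
  exact hCE N (le_trans (le_max_left _ _) hN) β c h
    (hNW N (le_trans (le_max_right _ _) hN) β c himp h hh)

/-- **Corollary:** (NP₁) from the two pieces. -/
theorem polyLoss_of_split (hCE : ComponentElimination) (hNW : NoWires) : AffBellsPolyLoss3 :=
  polyLoss_of_wrel (wrel_of_split hCE hNW)


/-- **P-38ak′ `WiredElimination` (L; the HONEST last box, ROUND-34 §12.12(t)).**  `NoWires` may fail for a harmless reason: an activity-robust
silent GADGET staircase (K-86a-type quadruples chained from light to wide forms) is a wire, costs nothing to fire, and does not make the
strategy any better — so a structural proof of `NoWires` cannot be local.  The right second piece is WREL restricted to WIRED components: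
at one level `e` (uniformly in the radii), if the position component of a `(log N)^C`-wide row reaches a row of width `< C₂ log N`, some
set containing a wide row can still be fired at cost `≤ 2^{N−1}/N^{e+2}`.  Expected proof: LOCAL RIGIDITY — robust silence near a wide
wire row can only come from a rigid bounded gadget (independent conditional twins randomise the class phase over 𝔽₄, cf. (t)), and a
rigid gadget is fired at cost = its failure mass. -/
def WiredElimination : Prop :=
  ∃ e : ℕ, ∀ C₁ C₂ : ℕ, ∃ C n₀ : ℕ, ∀ N ≥ n₀, ∀ (β : Fin N → Fin N → ZMod 3) (c : Fin N → ZMod 3),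
    (imperfectFibres β c).card * N ^ (e + 1) ≤ 2 * 2 ^ (N - 1) →
    ∀ b, (Nat.log 2 N) ^ C < (rowSupp β b).card →
      (∃ g ∈ posComponent (C₁ * Nat.log 2 N) β b, (rowSupp β g).card < C₂ * Nat.log 2 N) →
      ∃ (K : Finset (Fin N)) (c' : Fin N → ZMod 3), (∃ h ∈ K, (Nat.log 2 N) ^ C < (rowSupp β h).card) ∧
        (imperfectFibres (fireRows β K) c').card * N ^ (e + 2)
          ≤ (imperfectFibres β c).card * N ^ (e + 2) + 2 ^ (N - 1)

/-- Generalised firing (2026-08-29T10:30Z): the rows of `K` are zeroed and the residues `c'` are ARBITRARY — `c' h = 0` makes row `h`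
always-true, `c' h ≠ 0` always-false; both constants are needed, because an activity-robust silent gadget emulates a set of CONSTANT rows
of either sign (its class sum is `≡ |act ∩ K'| (mod 2)` for a sub-gadget `K'`), and firing it to the wrong constant flips half the fibres
(ROUND-34 §12.12(v)).  The fire-to-true form implies this one (`c' := fireRes c K`). -/
theorem wired_of_fireForm
    (h : ∃ e : ℕ, ∀ C₁ C₂ : ℕ, ∃ C n₀ : ℕ, ∀ N ≥ n₀, ∀ (β : Fin N → Fin N → ZMod 3) (c : Fin N → ZMod 3),
      (imperfectFibres β c).card * N ^ (e + 1) ≤ 2 * 2 ^ (N - 1) →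
      ∀ b, (Nat.log 2 N) ^ C < (rowSupp β b).card →
        (∃ g ∈ posComponent (C₁ * Nat.log 2 N) β b, (rowSupp β g).card < C₂ * Nat.log 2 N) →
        ∃ K : Finset (Fin N), (∃ h ∈ K, (Nat.log 2 N) ^ C < (rowSupp β h).card) ∧
          (imperfectFibres (fireRows β K) (fireRes c K)).card * N ^ (e + 2)
            ≤ (imperfectFibres β c).card * N ^ (e + 2) + 2 ^ (N - 1)) : WiredElimination := by
  obtain ⟨e, h⟩ := h
  refine ⟨e, fun C₁ C₂ => ?_⟩
  obtain ⟨C, n₀, h⟩ := h C₁ C₂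
  refine ⟨C, n₀, fun N hN β c himp b hb hw => ?_⟩
  obtain ⟨K, hK, hcost⟩ := h N hN β c himp b hb hw
  exact ⟨K, fireRes c K, hK, hcost⟩

/-- **The honest split is a proof too:** `ComponentElimination → WiredElimination → WideRowElimination`. -/
theorem wrel_of_split' (hCE : ComponentElimination) (hWE : WiredElimination) : WideRowElimination := by
  obtain ⟨e, hWE⟩ := hWE
  obtain ⟨C₁, C₂, n₀, hCE⟩ := hCE e
  obtain ⟨C, n₁, hWE⟩ := hWE C₁ C₂
  refine ⟨C, e, max n₀ n₁, fun N hN β c himp hwide => ?_⟩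
  obtain ⟨h, hh⟩ := hwide
  by_cases hlf : ∀ g ∈ posComponent (C₁ * Nat.log 2 N) β h, C₂ * Nat.log 2 N ≤ (rowSupp β g).card
  · exact ⟨posComponent (C₁ * Nat.log 2 N) β h, fireRes c _, ⟨h, mem_posComponent_self _ _ _, hh⟩,
      hCE N (le_trans (le_max_left _ _) hN) β c h hlf⟩
  · push Not at hlf
    exact hWE N (le_trans (le_max_right _ _) hN) β c himp h hh hlf

/-- `noWires_imp_wired` (planner qa-qnc0-p1 g35, exp35/WREL35.lean; see the section header above). -/
theorem noWires_imp_wired (hNW : NoWires) : WiredElimination := by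
  obtain ⟨e₀, hNW⟩ := hNW
  refine ⟨e₀, fun C₁ C₂ => ?_⟩
  obtain ⟨C, n₀, hNW⟩ := hNW C₁ C₂
  refine ⟨C, n₀, fun N hN β c himp b hb hwired => ?_⟩
  obtain ⟨g, hg, hlt⟩ := hwired
  exact absurd (hNW N hN β c himp b hb g hg) (by omega)

/-- `polyLoss_of_split'` (planner qa-qnc0-p1 g35, exp35/WREL35.lean; see the section header above). -/
theorem polyLoss_of_split' (hCE : ComponentElimination) (hWE : WiredElimination) : AffBellsPolyLoss3 :=
  polyLoss_of_wrel (wrel_of_split' hCE hWE)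



end Summit.QuantumAdvantage.AdviceFreeQNC0.AffBells35
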